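import Summits.QuantumFields.YangMills.Theorems.ColdStartUniversalityLatticeLangevinKernelActionContinuity
import HarnessLib

/-!
# Route `ColdStartUniversality` (fixed-cut-off package): the ground-state Duhamel identity, first form —
# extension from a dense class to all continuous observables, and its expansion under the reference kernels

Helper file (seat `ym-line-csu-p1`, g15).  ABSTRACT measure theory on a compact space `X`, no SZZ object; step 1 of 3 of
the proof that the Shen–Zhu–Zhu lattice Langevin semigroup is REVERSIBLE with respect to the Wilson measure (SZZ, CMP 400
(2023) §3 p. 13, «`P_t^L` is a `μ`-version of the `L²(μ)`-semigroup of the Dirichlet form `𝓔^L`», asserted without proof).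

Data: Markov kernel families `κ` (the dynamics) and `κ⁰` (the reference dynamics) whose actions `(s, x) ↦ ∫ G d(κ s x)` are
jointly continuous for continuous `G`; continuous `φ` (ground state) and `V` (potential).  Write
`T_a u (x) := ∫ u d(κ⁰_a x)` and `q_a u (x) := ∫ φ u d(κ_a x)` (real times read through `Real.toNNReal`).  The FIRST DUHAMEL FORM

  `q_t w (x) = φ(x) T_t w (x) - ∫₀ᵗ q_s (V · T_{t-s} w)(x) ds`                                            (D1)

(for the SU(2) SZZ system: `groundState_duhamel`, seat g8) is extended from a uniformly dense class `E` of continuous `w` to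
ALL continuous `w` (`duhamel_first_of_dense`), and expanded under a reference kernel (`duhamel_first_expanded`):

  `T_a (V φ⁻¹ q_r w)(x) = T_a (V T_r w)(x) - ∫₀ʳ T_a (V φ⁻¹ q_u (V T_{r-u} w))(x) du`                       (D1')

(Fubini against `κ⁰_a x`).  The joint-continuity lemmas `continuous_refAction_family` / `continuous_gsAction_family` make every
time integrand continuous.  No definition, no sorry.  RECORD-rung R3 plumbing; nothing here bears on the Yang–Mills mass gap.
-/

set_option autoImplicit false

noncomputable section

namespace Summit.QuantumFields.YangMills.Theorems.ColdStartUniversality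

open MeasureTheory ProbabilityTheory Filter Topology Set
open scoped NNReal

variable {X : Type*} [TopologicalSpace X] [CompactSpace X] [MeasurableSpace X] [BorelSpace X]

/-! ## Joint continuity of the two actions on moving observables -/

/-- **Reference action on a jointly continuous family**: `(p, x) ↦ ∫ u_p d(κ⁰_{τ(p)} x)` is jointly continuous. [folklore] -/
theorem continuous_refAction_family (κ₀ : ℝ≥0 → Kernel X X) [∀ t, IsMarkovKernel (κ₀ t)]
    (hT : ∀ G : X → ℝ, Continuous G → Continuous fun p : ℝ≥0 × X => ∫ y, G y ∂(κ₀ p.1 p.2))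
    {P : Type*} [TopologicalSpace P] {u : P → X → ℝ} (hu : Continuous (Function.uncurry u))
    {τ : P → ℝ} (hτ : Continuous τ) :
    Continuous fun q : P × X => ∫ y, u q.1 y ∂(κ₀ (τ q.1).toNNReal q.2) :=
  continuous_kernel_action_comp_real κ₀ hT hu hτ

/-- **Ground-state action on a jointly continuous family**: `(p, x) ↦ ∫ φ u_p d(κ_{τ(p)} x)` is jointly continuous.
[folklore] -/
theorem continuous_gsAction_family (κ : ℝ≥0 → Kernel X X) [∀ t, IsMarkovKernel (κ t)]
    (hK : ∀ G : X → ℝ, Continuous G → Continuous fun p : ℝ≥0 × X => ∫ y, G y ∂(κ p.1 p.2))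
    {φ : X → ℝ} (hφc : Continuous φ)
    {P : Type*} [TopologicalSpace P] {u : P → X → ℝ} (hu : Continuous (Function.uncurry u))
    {τ : P → ℝ} (hτ : Continuous τ) :
    Continuous fun q : P × X => ∫ y, φ y * u q.1 y ∂(κ (τ q.1).toNNReal q.2) := by
  have hu' : Continuous (Function.uncurry fun (p : P) (y : X) => φ y * u p y) :=
    (hφc.comp continuous_snd).mul hu
  exact continuous_kernel_action_comp_real κ hK hu' hτ

omit [CompactSpace X] [BorelSpace X] in
/-- Fixed-time form: `x ↦ ∫ u d(κ⁰_a x)` is continuous for continuous `u` (the Feller property, read in real time).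
[folklore] -/
theorem continuous_refAction (κ₀ : ℝ≥0 → Kernel X X) [∀ t, IsMarkovKernel (κ₀ t)]
    (hT : ∀ G : X → ℝ, Continuous G → Continuous fun p : ℝ≥0 × X => ∫ y, G y ∂(κ₀ p.1 p.2))
    {u : X → ℝ} (hu : Continuous u) (a : ℝ) : Continuous fun x => ∫ y, u y ∂(κ₀ a.toNNReal x) :=
  (hT u hu).comp ((continuous_const : Continuous fun _ : X => a.toNNReal).prodMk continuous_id)

omit [CompactSpace X] [BorelSpace X] in
/-- Fixed-time form: `x ↦ ∫ φ u d(κ_a x)` is continuous for continuous `u`. [folklore] -/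
theorem continuous_gsAction (κ : ℝ≥0 → Kernel X X) [∀ t, IsMarkovKernel (κ t)]
    (hK : ∀ G : X → ℝ, Continuous G → Continuous fun p : ℝ≥0 × X => ∫ y, G y ∂(κ p.1 p.2))
    {φ : X → ℝ} (hφc : Continuous φ) {u : X → ℝ} (hu : Continuous u) (a : ℝ) :
    Continuous fun x => ∫ y, φ y * u y ∂(κ a.toNNReal x) :=
  (hK (fun y => φ y * u y) (hφc.mul hu)).comp ((continuous_const : Continuous fun _ : X => a.toNNReal).prodMk continuous_id)

/-- The Duhamel time integrand `(s, x) ↦ q_s (V · T_{t-s} w)(x)` of (D1) is jointly continuous (so `IntervalIntegrable`).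
[folklore] -/
theorem continuous_duhamel_integrand (κ κ₀ : ℝ≥0 → Kernel X X) [∀ t, IsMarkovKernel (κ t)] [∀ t, IsMarkovKernel (κ₀ t)]
    (hK : ∀ G : X → ℝ, Continuous G → Continuous fun p : ℝ≥0 × X => ∫ y, G y ∂(κ p.1 p.2))
    (hT : ∀ G : X → ℝ, Continuous G → Continuous fun p : ℝ≥0 × X => ∫ y, G y ∂(κ₀ p.1 p.2))
    {φ V : X → ℝ} (hφc : Continuous φ) (hVc : Continuous V) {w : X → ℝ} (hw : Continuous w) (t : ℝ) :
    Continuous fun p : ℝ × X =>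
      ∫ y, φ y * (V y * ∫ z, w z ∂(κ₀ (t - p.1).toNNReal y)) ∂(κ p.1.toNNReal p.2) := by
  -- the moving observable `(s, y) ↦ V y · T_{t-s} w (y)`
  have hG : Continuous (Function.uncurry fun (s : ℝ) (y : X) => V y * ∫ z, w z ∂(κ₀ (t - s).toNNReal y)) := by
    have h1 : Continuous fun q : ℝ × X => ∫ z, w z ∂(κ₀ (t - q.1).toNNReal q.2) :=
      continuous_refAction_family κ₀ hT (u := fun (_ : ℝ) (z : X) => w z) (hw.comp continuous_snd)
        (continuous_const.sub continuous_id)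
    exact (hVc.comp continuous_snd).mul h1
  exact continuous_gsAction_family κ hK hφc hG continuous_id

/-! ## The first Duhamel form on all continuous observables -/

/-- **(D1) extends from a dense class to all continuous observables.**  If the first Duhamel form holds for every `w` in a
uniformly dense set `E` of continuous functions, it holds for every continuous `w` (all three terms are Lipschitz in `w`
for the sup-norm, the time integrand being continuous hence integrable). [folklore] -/
theorem duhamel_first_of_dense (κ κ₀ : ℝ≥0 → Kernel X X) [∀ t, IsMarkovKernel (κ t)] [∀ t, IsMarkovKernel (κ₀ t)]
    (hK : ∀ G : X → ℝ, Continuous G → Continuous fun p : ℝ≥0 × X => ∫ y, G y ∂(κ p.1 p.2))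
    (hT : ∀ G : X → ℝ, Continuous G → Continuous fun p : ℝ≥0 × X => ∫ y, G y ∂(κ₀ p.1 p.2))
    {φ V : X → ℝ} (hφc : Continuous φ) (hVc : Continuous V)
    (E : Set (X → ℝ)) (hEc : ∀ w ∈ E, Continuous w)
    (hEd : ∀ G : X → ℝ, Continuous G → ∀ ε : ℝ, 0 < ε → ∃ w ∈ E, ∀ x, |w x - G x| < ε)
    (hD : ∀ w ∈ E, ∀ (t : ℝ≥0) (x : X),
      ∫ y, φ y * w y ∂(κ t x) = φ x * ∫ y, w y ∂(κ₀ t x) -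
        ∫ s in (0 : ℝ)..(t : ℝ), ∫ y, φ y * (V y * ∫ z, w z ∂(κ₀ ((t : ℝ) - s).toNNReal y)) ∂(κ s.toNNReal x))
    {w : X → ℝ} (hw : Continuous w) (t : ℝ≥0) (x : X) :
    ∫ y, φ y * w y ∂(κ t x) = φ x * ∫ y, w y ∂(κ₀ t x) -
      ∫ s in (0 : ℝ)..(t : ℝ), ∫ y, φ y * (V y * ∫ z, w z ∂(κ₀ ((t : ℝ) - s).toNNReal y)) ∂(κ s.toNNReal x) := by
  obtain ⟨Φ, hΦ0, hΦ⟩ := exists_abs_le_of_continuous_of_compactSpace hφc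
  obtain ⟨K, hK0, hKV⟩ := exists_abs_le_of_continuous_of_compactSpace hVc
  have ht0 : (0 : ℝ) ≤ t := t.2
  -- the defect `LHS - RHS` as a function of the observable
  set Δ : (X → ℝ) → ℝ := fun u =>
    (∫ y, φ y * u y ∂(κ t x)) - (φ x * ∫ y, u y ∂(κ₀ t x) -
      ∫ s in (0 : ℝ)..(t : ℝ), ∫ y, φ y * (V y * ∫ z, u z ∂(κ₀ ((t : ℝ) - s).toNNReal y)) ∂(κ s.toNNReal x)) with hΔ
  suffices hzero : Δ w = 0 by
    have : Δ w = (∫ y, φ y * w y ∂(κ t x)) - (φ x * ∫ y, w y ∂(κ₀ t x) -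
      ∫ s in (0 : ℝ)..(t : ℝ), ∫ y, φ y * (V y * ∫ z, w z ∂(κ₀ ((t : ℝ) - s).toNNReal y)) ∂(κ s.toNNReal x)) := rfl
    rw [this] at hzero
    exact sub_eq_zero.1 hzero
  -- `Δ` vanishes on `E` and is Lipschitz: `|Δ u - Δ u'| ≤ C · sup |u - u'|`
  have hΔE : ∀ u ∈ E, Δ u = 0 := fun u hu => by
    rw [hΔ]; dsimp only; rw [hD u hu t x]; ring
  have hlip : ∀ (u u' : X → ℝ), Continuous u → Continuous u' → ∀ ε : ℝ, 0 ≤ ε → (∀ y, |u y - u' y| ≤ ε) →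
      |Δ u - Δ u'| ≤ (Φ + Φ + Φ * K * t) * ε := by
    intro u u' hu hu' ε hε hd
    -- term 1
    have h1 : |(∫ y, φ y * u y ∂(κ t x)) - ∫ y, φ y * u' y ∂(κ t x)| ≤ Φ * ε :=
      abs_integral_sub_integral_le_of_abs_sub_le (f := fun y => φ y * u y) (g := fun y => φ y * u' y)
        (hφc.mul hu) (hφc.mul hu') fun y => by
        rw [← mul_sub, abs_mul]; exact mul_le_mul (hΦ y) (hd y) (abs_nonneg _) hΦ0
    -- term 2
    have h2 : |φ x * (∫ y, u y ∂(κ₀ t x)) - φ x * ∫ y, u' y ∂(κ₀ t x)| ≤ Φ * ε := by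
      rw [← mul_sub, abs_mul]
      exact mul_le_mul (hΦ x) (abs_integral_sub_integral_le_of_abs_sub_le hu hu' hd) (abs_nonneg _) hΦ0
    -- term 3: continuous integrands, pointwise close
    set F : ℝ → ℝ := fun s => ∫ y, φ y * (V y * ∫ z, u z ∂(κ₀ ((t : ℝ) - s).toNNReal y)) ∂(κ s.toNNReal x) with hF
    set F' : ℝ → ℝ := fun s => ∫ y, φ y * (V y * ∫ z, u' z ∂(κ₀ ((t : ℝ) - s).toNNReal y)) ∂(κ s.toNNReal x) with hF'
    have hFc : Continuous F :=
      (continuous_duhamel_integrand κ κ₀ hK hT hφc hVc hu (t : ℝ)).comp (continuous_id.prodMk continuous_const)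
    have hF'c : Continuous F' :=
      (continuous_duhamel_integrand κ κ₀ hK hT hφc hVc hu' (t : ℝ)).comp (continuous_id.prodMk continuous_const)
    have hTuc : ∀ s : ℝ, Continuous fun y => ∫ z, u z ∂(κ₀ ((t : ℝ) - s).toNNReal y) := fun s =>
      continuous_refAction κ₀ hT hu _
    have hTu'c : ∀ s : ℝ, Continuous fun y => ∫ z, u' z ∂(κ₀ ((t : ℝ) - s).toNNReal y) := fun s =>
      continuous_refAction κ₀ hT hu' _
    have h3pt : ∀ s, |F s - F' s| ≤ Φ * K * ε := by
      intro s
      refine abs_integral_sub_integral_le_of_abs_sub_le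
        (f := fun y => φ y * (V y * ∫ z, u z ∂(κ₀ ((t : ℝ) - s).toNNReal y)))
        (g := fun y => φ y * (V y * ∫ z, u' z ∂(κ₀ ((t : ℝ) - s).toNNReal y)))
        (hφc.mul (hVc.mul (hTuc s))) (hφc.mul (hVc.mul (hTu'c s))) fun y => ?_
      have hin : |(∫ z, u z ∂(κ₀ ((t : ℝ) - s).toNNReal y)) - ∫ z, u' z ∂(κ₀ ((t : ℝ) - s).toNNReal y)| ≤ ε :=
        abs_integral_sub_integral_le_of_abs_sub_le hu hu' hd
      rw [← mul_sub, ← mul_sub, abs_mul, abs_mul]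
      calc |φ y| * (|V y| * |(∫ z, u z ∂(κ₀ ((t : ℝ) - s).toNNReal y)) - ∫ z, u' z ∂(κ₀ ((t : ℝ) - s).toNNReal y)|)
          ≤ Φ * (K * ε) := mul_le_mul (hΦ y) (mul_le_mul (hKV y) hin (abs_nonneg _) hK0) (by positivity) hΦ0
        _ = Φ * K * ε := by ring
    have h3 : |(∫ s in (0 : ℝ)..(t : ℝ), F s) - ∫ s in (0 : ℝ)..(t : ℝ), F' s| ≤ Φ * K * t * ε := by
      rw [← intervalIntegral.integral_sub (hFc.intervalIntegrable _ _) (hF'c.intervalIntegrable _ _)]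
      have h := intervalIntegral.norm_integral_le_of_norm_le_const (a := (0 : ℝ)) (b := (t : ℝ))
        (f := fun s => F s - F' s) (C := Φ * K * ε) fun s _ => by rw [Real.norm_eq_abs]; exact h3pt s
      rw [Real.norm_eq_abs, sub_zero, abs_of_nonneg ht0] at h
      calc |∫ s in (0 : ℝ)..(t : ℝ), F s - F' s| ≤ Φ * K * ε * t := h
        _ = Φ * K * t * ε := by ring
    -- combine
    have hΔdiff : Δ u - Δ u' = ((∫ y, φ y * u y ∂(κ t x)) - ∫ y, φ y * u' y ∂(κ t x)) -
        (φ x * (∫ y, u y ∂(κ₀ t x)) - φ x * ∫ y, u' y ∂(κ₀ t x)) +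
        ((∫ s in (0 : ℝ)..(t : ℝ), F s) - ∫ s in (0 : ℝ)..(t : ℝ), F' s) := by
      rw [hΔ]; dsimp only; rw [hF, hF']; ring
    rw [hΔdiff]
    calc _ ≤ |((∫ y, φ y * u y ∂(κ t x)) - ∫ y, φ y * u' y ∂(κ t x)) -
              (φ x * (∫ y, u y ∂(κ₀ t x)) - φ x * ∫ y, u' y ∂(κ₀ t x))| +
            |(∫ s in (0 : ℝ)..(t : ℝ), F s) - ∫ s in (0 : ℝ)..(t : ℝ), F' s| := abs_add_le _ _
      _ ≤ (Φ * ε + Φ * ε) + Φ * K * t * ε := add_le_add ((abs_sub _ _).trans (add_le_add h1 h2)) h3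
      _ = (Φ + Φ + Φ * K * t) * ε := by ring
  -- `Δ w` is smaller than every positive number
  refine abs_eq_zero.1 (le_antisymm (le_of_forall_pos_le_add fun δ hδ => ?_) (abs_nonneg _))
  have hC : 0 < Φ + Φ + Φ * K * t + 1 := by positivity
  obtain ⟨u, huE, hu⟩ := hEd w hw (δ / (Φ + Φ + Φ * K * t + 1)) (by positivity)
  have h := hlip w u hw (hEc u huE) (δ / (Φ + Φ + Φ * K * t + 1)) (by positivity) fun y => by
    rw [abs_sub_comm]; exact (hu y).le
  rw [hΔE u huE, sub_zero] at h
  calc |Δ w| ≤ (Φ + Φ + Φ * K * t) * (δ / (Φ + Φ + Φ * K * t + 1)) := h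
    _ ≤ (Φ + Φ + Φ * K * t + 1) * (δ / (Φ + Φ + Φ * K * t + 1)) :=
        mul_le_mul_of_nonneg_right (by linarith) (by positivity)
    _ = δ := mul_div_cancel₀ δ hC.ne'
    _ ≤ 0 + δ := by rw [zero_add]

/-! ## Expansion of the first form under a reference kernel -/

/-- **(D1') — the first Duhamel form expanded under `κ⁰_a`.**  For continuous `w`, `r ≥ 0` and any `a`:
`T_a (V φ⁻¹ q_r w)(x) = T_a (V · T_r w)(x) - ∫₀ʳ T_a (V φ⁻¹ q_u (V · T_{r-u} w))(x) du`, where the first form (D1) is assumed for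
all continuous observables (substitute (D1) at time `r` under the `κ⁰_a x`-integral and exchange it with `∫₀ʳ du`).
[folklore] -/
theorem duhamel_first_expanded (κ κ₀ : ℝ≥0 → Kernel X X) [∀ t, IsMarkovKernel (κ t)] [∀ t, IsMarkovKernel (κ₀ t)]
    (hK : ∀ G : X → ℝ, Continuous G → Continuous fun p : ℝ≥0 × X => ∫ y, G y ∂(κ p.1 p.2))
    (hT : ∀ G : X → ℝ, Continuous G → Continuous fun p : ℝ≥0 × X => ∫ y, G y ∂(κ₀ p.1 p.2))
    {φ V : X → ℝ} (hφc : Continuous φ) (hφpos : ∀ x, 0 < φ x) (hVc : Continuous V)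
    (hD : ∀ w : X → ℝ, Continuous w → ∀ (t : ℝ≥0) (x : X),
      ∫ y, φ y * w y ∂(κ t x) = φ x * ∫ y, w y ∂(κ₀ t x) -
        ∫ s in (0 : ℝ)..(t : ℝ), ∫ y, φ y * (V y * ∫ z, w z ∂(κ₀ ((t : ℝ) - s).toNNReal y)) ∂(κ s.toNNReal x))
    {w : X → ℝ} (hw : Continuous w) {r : ℝ} (hr : 0 ≤ r) (a : ℝ≥0) (x : X) :
    ∫ y, V y * (φ y)⁻¹ * (∫ z, φ z * w z ∂(κ r.toNNReal y)) ∂(κ₀ a x) =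
      (∫ y, V y * (∫ z, w z ∂(κ₀ r.toNNReal y)) ∂(κ₀ a x)) -
        ∫ u in (0 : ℝ)..r, (∫ y, V y * (φ y)⁻¹ *
          (∫ z, φ z * (V z * ∫ z', w z' ∂(κ₀ (r - u).toNNReal z)) ∂(κ u.toNNReal y)) ∂(κ₀ a x)) := by
  have hφne : ∀ y, φ y ≠ 0 := fun y => (hφpos y).ne'
  have hφic : Continuous fun y => (φ y)⁻¹ := hφc.inv₀ hφne
  -- the `(u, y)`-integrand of the correction term
  set B : ℝ → X → ℝ := fun u y =>
    ∫ z, φ z * (V z * ∫ z', w z' ∂(κ₀ (r - u).toNNReal z)) ∂(κ u.toNNReal y) with hB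
  have hBc : Continuous (Function.uncurry B) := continuous_duhamel_integrand κ κ₀ hK hT hφc hVc hw r
  have hI : Continuous (Function.uncurry fun (u : ℝ) (y : X) => V y * (φ y)⁻¹ * B u y) :=
    ((hVc.comp continuous_snd).mul (hφic.comp continuous_snd)).mul hBc
  have hI' : Continuous (Function.uncurry fun (y : X) (u : ℝ) => V y * (φ y)⁻¹ * B u y) := hI.comp continuous_swap
  -- (D1) at time `r` under the outer integral
  have hpt : ∀ y, V y * (φ y)⁻¹ * (∫ z, φ z * w z ∂(κ r.toNNReal y)) =
      V y * (∫ z, w z ∂(κ₀ r.toNNReal y)) - V y * (φ y)⁻¹ * ∫ u in (0 : ℝ)..r, B u y := by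
    intro y
    have h := hD w hw r.toNNReal y
    rw [Real.coe_toNNReal r hr] at h
    rw [h, mul_sub, ← mul_assoc, mul_assoc (V y) _ (φ y), inv_mul_cancel₀ (hφne y), mul_one]
  have hTw : Continuous fun y => ∫ z, w z ∂(κ₀ r.toNNReal y) := continuous_refAction κ₀ hT hw _
  have hA : Continuous fun y => V y * ∫ z, w z ∂(κ₀ r.toNNReal y) := hVc.mul hTw
  have hBin : Continuous fun y => ∫ u in (0 : ℝ)..r, V y * (φ y)⁻¹ * B u y :=
    intervalIntegral.continuous_parametric_intervalIntegral_of_continuous' hI' 0 r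
  have hcm : ∀ y, V y * (φ y)⁻¹ * (∫ u in (0 : ℝ)..r, B u y) = ∫ u in (0 : ℝ)..r, V y * (φ y)⁻¹ * B u y := fun y => by
    rw [intervalIntegral.integral_const_mul]
  have hB' : Continuous fun y => V y * (φ y)⁻¹ * ∫ u in (0 : ℝ)..r, B u y := by
    have h : (fun y => V y * (φ y)⁻¹ * ∫ u in (0 : ℝ)..r, B u y) = fun y => ∫ u in (0 : ℝ)..r, V y * (φ y)⁻¹ * B u y :=
      funext hcm
    rw [h]; exact hBin
  calc ∫ y, V y * (φ y)⁻¹ * (∫ z, φ z * w z ∂(κ r.toNNReal y)) ∂(κ₀ a x)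
      = ∫ y, (V y * (∫ z, w z ∂(κ₀ r.toNNReal y)) - V y * (φ y)⁻¹ * ∫ u in (0 : ℝ)..r, B u y) ∂(κ₀ a x) :=
        integral_congr_ae (Eventually.of_forall hpt)
    _ = (∫ y, V y * (∫ z, w z ∂(κ₀ r.toNNReal y)) ∂(κ₀ a x)) - ∫ y, V y * (φ y)⁻¹ * (∫ u in (0 : ℝ)..r, B u y) ∂(κ₀ a x) :=
        integral_sub (integrable_of_continuous_of_compactSpace hA _) (integrable_of_continuous_of_compactSpace hB' _)
    _ = (∫ y, V y * (∫ z, w z ∂(κ₀ r.toNNReal y)) ∂(κ₀ a x)) - ∫ y, (∫ u in (0 : ℝ)..r, V y * (φ y)⁻¹ * B u y) ∂(κ₀ a x) := by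
        congr 1
        exact integral_congr_ae (Eventually.of_forall hcm)
    _ = (∫ y, V y * (∫ z, w z ∂(κ₀ r.toNNReal y)) ∂(κ₀ a x)) - ∫ u in (0 : ℝ)..r, (∫ y, V y * (φ y)⁻¹ * B u y ∂(κ₀ a x)) := by
        rw [integral_intervalIntegral_swap_of_continuous (κ₀ a x) hI hr]

end Summit.QuantumFields.YangMills.Theorems.ColdStartUniversality

end
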